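import Mathlib
import Literature.NumberTheory.LFunctions.Zhang2022.Section7I1LineSeries
import Literature.NumberTheory.LFunctions.Zhang2022.Section7I1Kernel
import Literature.NumberTheory.LFunctions.Zhang2022.Section6ZfacBound
import Literature.NumberTheory.Sieve.LargeSieveCharacters
import HarnessLib

/-!
# Zhang (2022), §7 p. 35 (tex L1920): the integrand of `I₁(ψ)` on the line `σ = 3/2` — size,
# continuity, integrability (tools for `Z22:§7.u021`), kernel-checked

Topic `Literature/NumberTheory/LFunctions/Zhang2022` (Landau–Siegel audit tree; verdict-neutral).
Y. Zhang, *Discrete mean estimates and the Landau–Siegel zero*, arXiv:2211.02515v1 (2022)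
[Zhang2022LandauSiegel] — **an unrefereed manuscript under adjudication; nothing here asserts or
denies its Theorems 1–2.** Campaign D-0069 (discharge lane, layer L2); THEOREM-ONLY.

§7 p. 35 (tex L1917–1920), proof of Proposition 7.1, after (7.6):

> … by a trivial bound for `ϑ*(1−s)ω(s)` on `σ = 3/2`, the segment `𝒥(1)` can be replaced by the
> line `σ = 3/2`, with negligible errors.

This file supplies the "trivial bound … on `σ = 3/2`" for the modified integrand
`G(s) = τ(ψ̄)p^{s−1}ϑ*(1−s)·(Σ_m (κ∗a₁)(m)ψ(m)m^{−s})·A(𝐚₂;1−s,ψ̄)·ω(s)` (the integrand of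
`Section7bStatements.I1line`), its continuity and integrability along the line; the companion
`Section7I1Line.lean` assembles `Step7u021`.

| decl | content |
|---|---|
| `continuous_ApolyBar_line`, `continuous_lineIntegrand` | continuity of `t ↦ G(3/2+it)` and of its Dirichlet-polynomial factor (`ϑ*`, `ω` factors: the tree's `Section7I1Kernel.continuous_varthetaStar/continuous_omega_line`, sz-d03) |
| `norm_lineIntegrand_le` | `‖G(3/2+it)‖ ≤ K·(1+|t|)²·exp((1−(t−2πt₀)²)/(4𝓛₂²))`, `K = 16π²S·B²·p·(P/T²)^{3/2}·(√π/𝓛₂)`, `S = Σ_m τ₅(m)m^{−5/4}` |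
| `poly_gauss_le` | `(1+|t|)²e^{−(t−2πt₀)²/(8𝓛₂²)} ≤ 144𝓛¹⁰³⁸` (`D ≥ 9`) |
| `norm_lineIntegrand_le_gauss` | `‖G(3/2+it)‖ ≤ K·e·144𝓛¹⁰³⁸·e^{−(t−2πt₀)²/(8𝓛₂²)}` (`D ≥ 9`) |
| `integrable_lineIntegrand` | `t ↦ G(3/2+it)` is integrable on `ℝ` (`D ≥ 9`) |

No fact beyond Mathlib and tree theorems (FACT-LIST F-07 `|τ(ψ)|² = p`, F-09 Γ-bounds) is used.

## References

* Y. Zhang, arXiv:2211.02515v1 (2022), §7 (7.6) p. 35, tex L1917–1920; §2 (2.15).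
  [cite: Zhang2022LandauSiegel, §7 (7.6) p.35]
-/

noncomputable section

open Complex Real MeasureTheory Set Filter

namespace Literature.NumberTheory.LFunctions.Zhang2022.Section7I1Line

open Skeleton Section7bStatements

variable (c' : ℝ)

/-! ## The modified integrand `G` on the line `σ = 3/2` -/

variable {D : ℕ}

/-- Continuity of the Dirichlet polynomial `t ↦ A(𝐚₂;1−(3/2+it),ψ̄)` (a finite sum).
[cite: Zhang2022LandauSiegel, §7 p. 33] -/
theorem continuous_ApolyBar_line (x : Chr D) (a₂ : ℕ → ℂ) :
    Continuous fun t : ℝ => ApolyBar x a₂ (1 - ((3 / 2 : ℂ) + t * I)) := by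
  unfold ApolyBar Lemma81.dirPoly
  refine continuous_finsetSum _ fun n _ => ?_
  rcases Nat.eq_zero_or_pos n with rfl | hn
  · -- `n = 0`: the exponent `w = −(1 − s)` has `Re w = 1/2 ≠ 0`, so `0^w = 0` identically
    have hw : ∀ t : ℝ, ((3 / 2 : ℂ) + (t : ℂ) * I) - 1 ≠ 0 := by
      intro t h
      have := congrArg Complex.re h
      simp at this
      norm_num at this
    have e : (fun t : ℝ => a₂ 0 * x.ψ⁻¹ ((0 : ℕ) : ZMod x.p) *
        ((0 : ℕ) : ℂ) ^ (-(1 - ((3 / 2 : ℂ) + (t : ℂ) * I)))) = fun _ => 0 := by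
      ext t
      have hcp : ((0 : ℕ) : ℂ) ^ (-(1 - ((3 / 2 : ℂ) + (t : ℂ) * I))) = 0 := by
        rw [Nat.cast_zero]
        apply Complex.zero_cpow
        rw [neg_sub, Ne]
        exact hw t
      rw [hcp, mul_zero]
    rw [e]; exact continuous_const
  · refine Continuous.mul continuous_const ?_
    refine Continuous.cpow continuous_const (by fun_prop) fun t => ?_
    left
    exact_mod_cast hn

/-- **Continuity of the modified integrand along `σ = 3/2`.**
[cite: Zhang2022LandauSiegel, §7 p. 35, tex L1920] -/
theorem continuous_lineIntegrand (x : Chr D) {B : ℝ} {a₁ : ℕ → ℂ} (ha : ∀ n, ‖a₁ n‖ ≤ B)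
    (a₂ : ℕ → ℂ) :
    Continuous fun t : ℝ =>
      GammaFactor.tau x.ψ⁻¹ * (x.p : ℂ) ^ (((3 / 2 : ℂ) + t * I) - 1) *
        GammaFactor.varthetaStarOneSub ((3 / 2 : ℂ) + t * I) *
        LSeries (fun m => kappaConv c' D a₁ m * x.ψ (m : ZMod x.p)) ((3 / 2 : ℂ) + t * I) *
        ApolyBar x a₂ (1 - ((3 / 2 : ℂ) + t * I)) * omegaW D ((3 / 2 : ℂ) + t * I) := by
  have hp : Continuous fun t : ℝ => (x.p : ℂ) ^ (((3 / 2 : ℂ) + (t : ℂ) * I) - 1) := by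
    refine Continuous.cpow continuous_const (by fun_prop) fun t => Or.inl ?_
    exact_mod_cast x.prime.pos
  exact ((((continuous_const.mul hp).mul Section7I1Kernel.continuous_varthetaStar).mul
    (continuous_lseries_line c' x ha)).mul (continuous_ApolyBar_line x a₂)).mul
    (Section7I1Kernel.continuous_omega_line D)

/-- **"By a trivial bound for `ϑ*(1−s)ω(s)` on `σ = 3/2`", made explicit**: for `ψ (mod p) ∈ Ψ`,
`‖a₁‖, ‖a₂‖ ≤ B` with `a₂` supported below `PT⁻²` ((7.2)), and every real `t`, the modified integrand
`G(3/2+it) = τ(ψ̄)p^{s−1}ϑ*(1−s)(Σ_m (κ∗a₁)(m)ψ(m)m^{−s})A(𝐚₂;1−s,ψ̄)ω(s)` satisfies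
`‖G(3/2+it)‖ ≤ K·(1+|t|)²·exp((1 − (t−2πt₀)²)/(4𝓛₂²))` with
`K = 16π²S·B²·p·(P/T²)^{3/2}·(√π/𝓛₂)`, `S = Σ_m τ₅(m)m^{−5/4}`
(`|τ(ψ̄)| = √p`, `|p^{s−1}| = √p`, `norm_varthetaStar_le`, `lseries_summable_and_norm_le`,
the tree's `norm_ApolyBar_le`, and `|ω(3/2+it)|` EXACT from `SmoothWeight.norm_omega_eq`).
[cite: Zhang2022LandauSiegel, §7 p. 35, tex L1920] -/
theorem norm_lineIntegrand_le (x : Chr D) {B : ℝ} {a₁ a₂ : ℕ → ℂ} (ha₁ : ∀ n, ‖a₁ n‖ ≤ B)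
    (ha₂ : Adm72 D B a₂) (hℓ₂ : 0 < ell2 D) (t : ℝ) :
    ‖GammaFactor.tau x.ψ⁻¹ * (x.p : ℂ) ^ (((3 / 2 : ℂ) + t * I) - 1) *
        GammaFactor.varthetaStarOneSub ((3 / 2 : ℂ) + t * I) *
        LSeries (fun m => kappaConv c' D a₁ m * x.ψ (m : ZMod x.p)) ((3 / 2 : ℂ) + t * I) *
        ApolyBar x a₂ (1 - ((3 / 2 : ℂ) + t * I)) * omegaW D ((3 / 2 : ℂ) + t * I)‖ ≤
      (16 * π ^ 2 * (∑' m : ℕ, MeanSquareMajorant.tau 5 m * (m : ℝ) ^ (-(5 / 4 : ℝ))) * B ^ 2 *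
          (x.p : ℝ) * (bigP D / bigT D ^ 2) ^ (3 / 2 : ℝ) * (Real.sqrt π / ell2 D)) *
        (1 + |t|) ^ 2 * Real.exp ((1 - (t - 2 * π * t0 D) ^ 2) / (4 * ell2 D ^ 2)) := by
  have hB : 0 ≤ B := (norm_nonneg _).trans (ha₁ 0)
  haveI : NeZero x.p := ⟨x.prime.ne_zero⟩
  have hp0 : (0 : ℝ) < x.p := by exact_mod_cast x.prime.pos
  set s : ℂ := (3 / 2 : ℂ) + (t : ℂ) * I with hs
  have hre : s.re = 3 / 2 := by simp [hs]
  have him : s.im = t := by simp [hs]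
  set S : ℝ := ∑' m : ℕ, MeanSquareMajorant.tau 5 m * (m : ℝ) ^ (-(5 / 4 : ℝ)) with hS
  have hS0 : 0 ≤ S := tsum_nonneg fun m => mul_nonneg (MeanSquareMajorant.tau_nonneg 5 m)
    (Real.rpow_nonneg (Nat.cast_nonneg m) _)
  -- the six factors
  have hτ : ‖GammaFactor.tau x.ψ⁻¹‖ = Real.sqrt x.p := by
    have h := Sieve.LargeSieve.norm_gaussSum_sq (Sieve.LargeSieve.isPrimitive_inv x.prim)
    rw [← Real.sqrt_sq (norm_nonneg (gaussSum x.ψ⁻¹ (ZMod.stdAddChar (N := x.p)))), h]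
  have hp : ‖(x.p : ℂ) ^ (s - 1)‖ = Real.sqrt x.p := by
    rw [Complex.norm_natCast_cpow_of_pos x.prime.pos, Real.sqrt_eq_rpow]
    congr 1
    rw [Complex.sub_re, hre, Complex.one_re]; norm_num
  have hθ := norm_varthetaStar_le t
  obtain ⟨_, hM⟩ := lseries_summable_and_norm_le c' x ha₁ (s := s) (by rw [hre]; norm_num)
  have hA : ‖ApolyBar x a₂ (1 - s)‖ ≤ B * (bigP D / bigT D ^ 2) ^ (3 / 2 : ℝ) := by
    have h := Section7aStatements.norm_ApolyBar_le x ha₂ (s := s) (by rw [hre]; norm_num)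
    rwa [hre] at h
  have hω : ‖omegaW D s‖ =
      Real.sqrt π / ell2 D * Real.exp ((1 - (t - 2 * π * t0 D) ^ 2) / (4 * ell2 D ^ 2)) := by
    rw [omegaW, SmoothWeight.norm_omega_eq hℓ₂, hre, him]
    norm_num
  have hsqrt : Real.sqrt x.p * Real.sqrt x.p = x.p := Real.mul_self_sqrt hp0.le
  have hP0 : 0 ≤ (bigP D / bigT D ^ 2) ^ (3 / 2 : ℝ) := by
    apply Real.rpow_nonneg; rw [bigP, bigT]; positivity
  have hE : 0 ≤ Real.exp ((1 - (t - 2 * π * t0 D) ^ 2) / (4 * ell2 D ^ 2)) := (Real.exp_pos _).le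
  have hω0 : 0 ≤ Real.sqrt π / ell2 D := div_nonneg (Real.sqrt_nonneg _) hℓ₂.le
  calc ‖GammaFactor.tau x.ψ⁻¹ * (x.p : ℂ) ^ (s - 1) * GammaFactor.varthetaStarOneSub s *
        LSeries (fun m => kappaConv c' D a₁ m * x.ψ (m : ZMod x.p)) s *
        ApolyBar x a₂ (1 - s) * omegaW D s‖
      = ‖GammaFactor.tau x.ψ⁻¹‖ * ‖(x.p : ℂ) ^ (s - 1)‖ * ‖GammaFactor.varthetaStarOneSub s‖ *
          ‖LSeries (fun m => kappaConv c' D a₁ m * x.ψ (m : ZMod x.p)) s‖ *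
          ‖ApolyBar x a₂ (1 - s)‖ * ‖omegaW D s‖ := by simp only [norm_mul]
    _ ≤ Real.sqrt x.p * Real.sqrt x.p * (16 * π ^ 2 * (1 + |t|) ^ 2) * (B * S) *
          (B * (bigP D / bigT D ^ 2) ^ (3 / 2 : ℝ)) *
          (Real.sqrt π / ell2 D * Real.exp ((1 - (t - 2 * π * t0 D) ^ 2) / (4 * ell2 D ^ 2))) := by
        rw [hτ, hp, hω]
        gcongr
    _ = (16 * π ^ 2 * S * B ^ 2 * (x.p : ℝ) * (bigP D / bigT D ^ 2) ^ (3 / 2 : ℝ) *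
          (Real.sqrt π / ell2 D)) * (1 + |t|) ^ 2 *
          Real.exp ((1 - (t - 2 * π * t0 D) ^ 2) / (4 * ell2 D ^ 2)) := by
        rw [hsqrt]; ring

/-! ## A Gaussian majorant and integrability along the line -/

/-- Real-variable core of the polynomial-times-Gaussian bound: for `c ≥ 0`, `L > 0` and every `t`,
`(1+|t|)²e^{−(t−c)²/(8L)} ≤ 2(1+c)² + 16L` (`1+|t| ≤ 1+c+|t−c|`, `x²e^{−x²/(8L)} ≤ 8L`). [folklore] -/
private theorem poly_gauss_aux {c L : ℝ} (hc0 : 0 ≤ c) (hL0 : 0 < L) (t : ℝ) :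
    (1 + |t|) ^ 2 * Real.exp (-(1 / (8 * L)) * (t - c) ^ 2) ≤ 2 * (1 + c) ^ 2 + 16 * L := by
  have ht : |t| ≤ c + |t - c| := by
    calc |t| = |c + (t - c)| := by ring_nf
      _ ≤ |c| + |t - c| := abs_add_le _ _
      _ = c + |t - c| := by rw [abs_of_nonneg hc0]
  have hE0 : 0 < Real.exp (-(1 / (8 * L)) * (t - c) ^ 2) := Real.exp_pos _
  have hE1 : Real.exp (-(1 / (8 * L)) * (t - c) ^ 2) ≤ 1 := by
    apply Real.exp_le_one_iff.mpr
    have h1 : 0 ≤ (t - c) ^ 2 := sq_nonneg _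
    have h2 : 0 ≤ 1 / (8 * L) := by positivity
    have := mul_nonneg h2 h1
    linarith
  -- `x² e^{−x²/(8L)} ≤ 8L` with `y = x²/(8L) ≤ e^y`
  have hxe : (t - c) ^ 2 * Real.exp (-(1 / (8 * L)) * (t - c) ^ 2) ≤ 8 * L := by
    have hy0 : 0 ≤ (t - c) ^ 2 / (8 * L) := by positivity
    have hx2 : (t - c) ^ 2 = 8 * L * ((t - c) ^ 2 / (8 * L)) := by field_simp
    have hey : (t - c) ^ 2 / (8 * L) ≤ Real.exp ((t - c) ^ 2 / (8 * L)) := by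
      linarith [Real.add_one_le_exp ((t - c) ^ 2 / (8 * L))]
    have e1 : -(1 / (8 * L)) * (t - c) ^ 2 = -((t - c) ^ 2 / (8 * L)) := by field_simp
    rw [e1]
    have hEE : Real.exp ((t - c) ^ 2 / (8 * L)) * Real.exp (-((t - c) ^ 2 / (8 * L))) = 1 := by
      rw [← Real.exp_add, add_neg_cancel, Real.exp_zero]
    have hEn : 0 < Real.exp (-((t - c) ^ 2 / (8 * L))) := Real.exp_pos _
    calc (t - c) ^ 2 * Real.exp (-((t - c) ^ 2 / (8 * L)))
        = 8 * L * ((t - c) ^ 2 / (8 * L)) * Real.exp (-((t - c) ^ 2 / (8 * L))) := by rw [← hx2]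
      _ ≤ 8 * L * Real.exp ((t - c) ^ 2 / (8 * L)) * Real.exp (-((t - c) ^ 2 / (8 * L))) := by
          gcongr
      _ = 8 * L := by rw [mul_assoc, hEE, mul_one]
  have h1 : (1 + |t|) ^ 2 ≤ 2 * (1 + c) ^ 2 + 2 * (t - c) ^ 2 := by
    have h1' : 1 + |t| ≤ (1 + c) + |t - c| := by linarith
    have h0 : 0 ≤ 1 + |t| := by positivity
    have h2 : (1 + |t|) ^ 2 ≤ ((1 + c) + |t - c|) ^ 2 := pow_le_pow_left₀ h0 h1' 2
    have h3 : ((1 + c) + |t - c|) ^ 2 ≤ 2 * (1 + c) ^ 2 + 2 * |t - c| ^ 2 := by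
      nlinarith [sq_nonneg ((1 + c) - |t - c|)]
    rw [sq_abs] at h3
    linarith
  calc (1 + |t|) ^ 2 * Real.exp (-(1 / (8 * L)) * (t - c) ^ 2)
      ≤ (2 * (1 + c) ^ 2 + 2 * (t - c) ^ 2) * Real.exp (-(1 / (8 * L)) * (t - c) ^ 2) :=
        mul_le_mul_of_nonneg_right h1 hE0.le
    _ = 2 * (1 + c) ^ 2 * Real.exp (-(1 / (8 * L)) * (t - c) ^ 2) +
          2 * ((t - c) ^ 2 * Real.exp (-(1 / (8 * L)) * (t - c) ^ 2)) := by ring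
    _ ≤ 2 * (1 + c) ^ 2 * 1 + 2 * (8 * L) := by gcongr
    _ = 2 * (1 + c) ^ 2 + 16 * L := by ring

/-- The polynomial factor against half of the Gaussian: for `D ≥ 9`, `c = 2πt₀` and every real `t`,
`(1+|t|)²·e^{−(t−c)²/(8𝓛₂²)} ≤ 144𝓛¹⁰³⁸` (`1+|t| ≤ 1 + c + |t−c|`, `c ≤ 7𝓛⁵¹⁹`,
`x²e^{−x²/(8𝓛₂²)} ≤ 8𝓛₂² = 8𝓛⁸⁰⁰`). [cite: Zhang2022LandauSiegel, §7 p. 35, tex L1920] -/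
theorem poly_gauss_le {D : ℕ} (hD : 9 ≤ D) (t : ℝ) :
    (1 + |t|) ^ 2 * Real.exp (-(1 / (8 * ell2 D ^ 2)) * (t - 2 * π * t0 D) ^ 2) ≤
      144 * ell D ^ 1038 := by
  have hℓ := Section6TailBounds.two_le_ell hD
  have hℓ0 : 0 < ell D := by linarith
  have hc0 : 0 ≤ 2 * π * t0 D := by rw [t0]; positivity
  have hL0 : 0 < ell2 D ^ 2 := by rw [ell2]; positivity
  have h := poly_gauss_aux hc0 hL0 t
  have h519 : (1 : ℝ) ≤ ell D ^ 519 := one_le_pow₀ (by linarith)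
  have hc7 : 2 * π * t0 D ≤ 7 * ell D ^ 519 := by
    rw [t0]
    have : 2 * π ≤ 7 := by linarith [Real.pi_lt_d2]
    exact mul_le_mul_of_nonneg_right this (by positivity)
  have hc8 : 1 + 2 * π * t0 D ≤ 8 * ell D ^ 519 := by linarith
  have h1c : (1 + 2 * π * t0 D) ^ 2 ≤ (8 * ell D ^ 519) ^ 2 := pow_le_pow_left₀ (by linarith) hc8 2
  have h64 : (8 * ell D ^ 519) ^ 2 = 64 * ell D ^ 1038 := by ring
  have hL : ell2 D ^ 2 = ell D ^ 800 := by rw [ell2]; ring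
  have h800 : ell D ^ 800 ≤ ell D ^ 1038 := Section6TailBounds.ell_pow_le_pow hD (by norm_num)
  rw [h64] at h1c
  rw [hL] at h ⊢
  linarith

/-- **A Gaussian majorant for the modified integrand** (for `D ≥ 9`, every real `t`):
`‖G(3/2+it)‖ ≤ K·e·144𝓛¹⁰³⁸·exp(−(t−2πt₀)²/(8𝓛₂²))`, `K` as in `norm_lineIntegrand_le`.
[cite: Zhang2022LandauSiegel, §7 p. 35, tex L1920] -/
theorem norm_lineIntegrand_le_gauss {D : ℕ} (hD : 9 ≤ D) (x : Chr D) {B : ℝ} {a₁ a₂ : ℕ → ℂ}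
    (ha₁ : ∀ n, ‖a₁ n‖ ≤ B) (ha₂ : Adm72 D B a₂) (t : ℝ) :
    ‖GammaFactor.tau x.ψ⁻¹ * (x.p : ℂ) ^ (((3 / 2 : ℂ) + t * I) - 1) *
        GammaFactor.varthetaStarOneSub ((3 / 2 : ℂ) + t * I) *
        LSeries (fun m => kappaConv c' D a₁ m * x.ψ (m : ZMod x.p)) ((3 / 2 : ℂ) + t * I) *
        ApolyBar x a₂ (1 - ((3 / 2 : ℂ) + t * I)) * omegaW D ((3 / 2 : ℂ) + t * I)‖ ≤
      (16 * π ^ 2 * (∑' m : ℕ, MeanSquareMajorant.tau 5 m * (m : ℝ) ^ (-(5 / 4 : ℝ))) * B ^ 2 *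
          (x.p : ℝ) * (bigP D / bigT D ^ 2) ^ (3 / 2 : ℝ) * (Real.sqrt π / ell2 D)) *
        (Real.exp 1 * (144 * ell D ^ 1038)) *
        Real.exp (-(1 / (8 * ell2 D ^ 2)) * (t - 2 * π * t0 D) ^ 2) := by
  have hℓ := Section6TailBounds.two_le_ell hD
  have hℓ0 : 0 < ell D := by linarith
  have hℓ₂ : 0 < ell2 D := by rw [ell2]; positivity
  have hℓ₂1 : 1 ≤ ell2 D := by rw [ell2]; exact one_le_pow₀ (by linarith)
  have h := norm_lineIntegrand_le c' x ha₁ ha₂ hℓ₂ t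
  set K : ℝ := 16 * π ^ 2 * (∑' m : ℕ, MeanSquareMajorant.tau 5 m * (m : ℝ) ^ (-(5 / 4 : ℝ))) *
    B ^ 2 * (x.p : ℝ) * (bigP D / bigT D ^ 2) ^ (3 / 2 : ℝ) * (Real.sqrt π / ell2 D) with hK
  have hS0 : 0 ≤ ∑' m : ℕ, MeanSquareMajorant.tau 5 m * (m : ℝ) ^ (-(5 / 4 : ℝ)) :=
    tsum_nonneg fun m => mul_nonneg (MeanSquareMajorant.tau_nonneg 5 m)
      (Real.rpow_nonneg (Nat.cast_nonneg m) _)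
  have hK0 : 0 ≤ K := by
    rw [hK]
    have : 0 ≤ (bigP D / bigT D ^ 2) ^ (3 / 2 : ℝ) := by
      apply Real.rpow_nonneg; rw [bigP, bigT]; positivity
    have : 0 ≤ Real.sqrt π / ell2 D := div_nonneg (Real.sqrt_nonneg _) hℓ₂.le
    positivity
  -- split the exponential
  set u : ℝ := t - 2 * π * t0 D with hu
  have hsplit : Real.exp ((1 - u ^ 2) / (4 * ell2 D ^ 2)) =
      Real.exp (1 / (4 * ell2 D ^ 2)) * Real.exp (-(1 / (8 * ell2 D ^ 2)) * u ^ 2) *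
        Real.exp (-(1 / (8 * ell2 D ^ 2)) * u ^ 2) := by
    rw [← Real.exp_add, ← Real.exp_add]
    congr 1
    field_simp
    ring
  have he1 : Real.exp (1 / (4 * ell2 D ^ 2)) ≤ Real.exp 1 := by
    apply Real.exp_le_exp.mpr
    rw [div_le_one (by positivity)]
    nlinarith
  have hpg := poly_gauss_le hD t
  rw [← hu] at hpg
  have hE : 0 ≤ Real.exp (-(1 / (8 * ell2 D ^ 2)) * u ^ 2) := (Real.exp_pos _).le
  calc _ ≤ K * (1 + |t|) ^ 2 * Real.exp ((1 - u ^ 2) / (4 * ell2 D ^ 2)) := h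
    _ = K * (Real.exp (1 / (4 * ell2 D ^ 2)) *
          ((1 + |t|) ^ 2 * Real.exp (-(1 / (8 * ell2 D ^ 2)) * u ^ 2))) *
          Real.exp (-(1 / (8 * ell2 D ^ 2)) * u ^ 2) := by rw [hsplit]; ring
    _ ≤ K * (Real.exp 1 * (144 * ell D ^ 1038)) * Real.exp (-(1 / (8 * ell2 D ^ 2)) * u ^ 2) := by
        gcongr

/-- **Integrability of the modified integrand along `σ = 3/2`** (continuous, with the Gaussian
majorant `norm_lineIntegrand_le_gauss`), for `D ≥ 9`. [cite: Zhang2022LandauSiegel, §7 p. 35, tex L1920] -/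
theorem integrable_lineIntegrand {D : ℕ} (hD : 9 ≤ D) (x : Chr D) {B : ℝ} {a₁ a₂ : ℕ → ℂ}
    (ha₁ : ∀ n, ‖a₁ n‖ ≤ B) (ha₂ : Adm72 D B a₂) :
    Integrable fun t : ℝ =>
      GammaFactor.tau x.ψ⁻¹ * (x.p : ℂ) ^ (((3 / 2 : ℂ) + t * I) - 1) *
        GammaFactor.varthetaStarOneSub ((3 / 2 : ℂ) + t * I) *
        LSeries (fun m => kappaConv c' D a₁ m * x.ψ (m : ZMod x.p)) ((3 / 2 : ℂ) + t * I) *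
        ApolyBar x a₂ (1 - ((3 / 2 : ℂ) + t * I)) * omegaW D ((3 / 2 : ℂ) + t * I) := by
  have hℓ := Section6TailBounds.two_le_ell hD
  have hℓ₂ : 0 < ell2 D := by rw [ell2]; positivity
  have hb : 0 < 1 / (8 * ell2 D ^ 2) := by positivity
  have hg : Integrable fun t : ℝ =>
      (16 * π ^ 2 * (∑' m : ℕ, MeanSquareMajorant.tau 5 m * (m : ℝ) ^ (-(5 / 4 : ℝ))) * B ^ 2 *
          (x.p : ℝ) * (bigP D / bigT D ^ 2) ^ (3 / 2 : ℝ) * (Real.sqrt π / ell2 D)) *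
        (Real.exp 1 * (144 * ell D ^ 1038)) *
        Real.exp (-(1 / (8 * ell2 D ^ 2)) * (t - 2 * π * t0 D) ^ 2) :=
    ((integrable_exp_neg_mul_sq hb).comp_sub_right (2 * π * t0 D)).const_mul _
  exact hg.mono' (continuous_lineIntegrand c' x ha₁ a₂).aestronglyMeasurable
    (ae_of_all _ fun t => norm_lineIntegrand_le_gauss c' hD x ha₁ ha₂ t)

end Literature.NumberTheory.LFunctions.Zhang2022.Section7I1Line
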